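import Mathlib
import HarnessLib
import HarnessLib.Audit
import Summits.AtomisticToContinuum.Statement
import Literature.Geometry.DiscreteGeometry.KissingPatterns
import Literature.MathematicalPhysics.StatisticalMechanics.BarlowStacking
import Literature.MathematicalPhysics.StatisticalMechanics.HaggStacking
import Literature.MathematicalPhysics.StatisticalMechanics.LennardJonesClusters
import Summits.AtomisticToContinuum.Crystallization.Theorems.ReggeStarCoercivityDefectFreeCrystallizesHullCriterion
import Summits.AtomisticToContinuum.Crystallization.Theorems.ExcessDecayLiouvilleCrysEnergyLimit

/-!
Route: EqualityFreeCertificates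

CLOSED (retired) 2026-08-15T13:42:13Z by operator:999:1257524 — reason: not-a-thesis: assembly does not conclude the sub-problem Statement — note: D-0027 §2.1 audit (human 2026-08-15: routes that do not decide the summit are removed): the assembly concludes `Literature.MathematicalPhysics.StatisticalMechanics.Crystallization`, not the sub-problem statement; a NEW conforming route may be opened from the same idea (generated `closes : … → _root_. The file is kept as the record of this route; refuted decls are indexed as negative knowledge (`ledger negatives`).

# Route EqualityFreeCertificates — "computers never see an equality": phonon convexity for the near
field, slack-only transfer certificates for the far field

Realises idea card equality-free-certificates-phonon-near-field (novelty audit: new-combination). It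
suffices to show
X = EfcBadOnlyGap ∧ EfcCompactStability ∧ EfcInterfaceGlue ∧ EfcHullBridge — a COERCIVE TWO-SHELL
ENERGY INEQUALITY for
Lennard-Jones V = r⁻¹²/12 − r⁻⁶/6 in ℝ³, organised so that no equality case is ever certified by a
computer.
GOODNESS (inline predicate, decide-checked patterns): particle i of a finite configuration x is
ε-GOOD iff for one scale
a ∈ [47/50, 1], one linear isometry A and one of the two 18-point patterns P₂ ∈ {fcc two-shell =
cuboctahedron ∪ octahedron at √2
= scaledPattern (fccInt ∪ {±2eₖ}) 2, hcp two-shell = anticuboctahedron ∪ its six √2-neighbours =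
scaledPattern (hcpInt ∪
{(6,0,0),(0,6,0),(0,0,6),(2,−4,−4),(−4,2,−4),(−4,−4,2)}) 18} there is an injective f : P₂ →
particles with |x_{f(v)} − (x_i + a·A v)| ≤ ε a
for all v and every particle within 3a/2 of x_i in the image (two-way match; surface particles are
BAD). Window [47/50,1] is the
window of LayeredWindows (stmt-3241, route HullPeriodicPoint), on which this route lands.
TARGET EfcCoerciveGap (rank 0): for every ε ∈ (0, 1/20] and δ > 0 there is g > 0 with 𝓔(x) ≥ N·e* +
g·#{ε-bad particles of x}
for every δ-separated N-point configuration x, e* = ⨅ over periodic Q of e(Q). The g = 0 skeleton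
N·e* ≤ 𝓔(x) is free
(periodisation, stmt-0715); the content is the coercivity, i.e. zero density of ε-bad particles in
ground states at every ε.
(FAR FIELD) EfcBadOnlyGap, rank 2: δ-separated configurations in which EVERY particle is 1/20-bad
satisfy 𝓔 ≥ N·(e* + g(δ)), g > 0:
slack only — no perfect-crystal (equality) configuration is in scope — the regime where transfer
certificates found by LP
and certified by interval branch-and-bound over decorated tame (Hales) fans terminate.
(NEAR FIELD) EfcCompactStability, rank 3: the perfect hcp and fcc Lennard-Jones crystals (nn
distance a ∈ [24/25, 49/50],
|h² − 2a²/3| ≤ a²/100; forces vanish by symmetry, so this is second order) lose no energy under any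
compactly supported
rearrangement keeping every particle 1/20-good: certified phonon + elastic positive-definiteness and
a geometric-nonlinear
(co-rotated, E–Ming / FJM) expansion — the only place the optimum is touched, and it is touched
analytically.
(GLUE) EfcInterfaceGlue, rank 4: far + near ⇒ target; the interface levy and the r⁻⁶ tail charge (g
must beat the tail /
interface constant — this fixes the certificate radius, expected 2–2.5 shells).
(BRIDGE) EfcHullBridge, rank 5: target + [E(N)/N → e*] (stmt-0626) ⇒ LayeredWindows (stmt-3241):
zero density of ε-bad particles
at every ε, local limits along a diagonal ε_N → 0, exact two-shell goodness ⇒ HasFccOrHcpShells ⇒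
the PROVED
HalesDSP_layerPackings_holds.
Lean, one line: `EfcBadOnlyGap ∧ EfcCompactStability ∧ EfcInterfaceGlue ∧ EfcHullBridge` (decls of
this file; every constant exists:
Literature.MathematicalPhysics.StatisticalMechanics.{lennardJones, interactionEnergy,
PeriodicConfiguration.energyPerParticle,
IsGroundState, groundStateEnergy, hcpStacking, fccStacking, IsHaggSeq, haggLabel, triangularVec₁,
triangularVec₂, barlowOffset,
layerNormal, IsCrystallizing, Crystallization}, Literature.Geometry.DiscreteGeometry.{scaledPattern,
fccInt, hcpInt}).

## Assembly
Pure logic (rc 0 in the planner's Sketch.lean, term `fun hB hC hG hLim hBr hPGL hHC hMin =>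
crystallization_of_isLeast_tendsto_isCrystallizing ⟨hMin, hLim, hHC (fun x hx => hPGL x hx ((hBr (hG
hB hC) hLim) x hx))⟩`):
EfcBadOnlyGap → EfcCompactStability → EfcInterfaceGlue → EfcEnergyLimit (0626) → EfcHullBridge →
EfcPeriodicGivenLayered (3242) →
EfcHullCriterion (3243, uses PeriodicWindows 3240) → EfcPeriodicMinAttained (0627) →
Literature.MathematicalPhysics.StatisticalMechanics.Crystallization.
The six support items are VERBATIM re-files of shared statements (0626, 0627 and HullPeriodicPoint's
3240–3243): this route supplies
HullPeriodicPoint's rank-2 crux LayeredWindows from an energy inequality and borrows its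
stacking-selection back end.

Rationale: WHY THIS LINE. Every successful computer proof near this problem isolates the optimum analytically
and lets the machine certify
only STRICT inequalities (Hales–Ferguson: local optimality of the fcc/hcp decomposition stars by
separate arguments, Hales1997;
Flyspeck: thousands of nonlinear inequalities each with margin, HalesDSP2012 Ch. 6–7,
HalesEtAl2015). For an ENERGY the natural
isolating tool exists and is unavailable for packing DENSITY: the harmonic approximation.
Lennard-Jones equality cases are
Morse–Bott clean (lattice × rigid motions), so the near field is an analytic convexity statement
resting on ONE certified
eigenvalue computation (E–Ming EMing2006, Friesecke–Theil FrieseckeTheil2002, FJM rigidity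
FrieseckeJamesMuller2002; tooling
now demonstrated for LJ fcc at N = 864 by AyalaChoksiWirth2025 arXiv:2506.22614), while the far
field — environments 1/20-far from
both two-shell patterns — carries a genuine gap (own uncertified numerics of the card:
Mackay/anti-Mackay centres lose 4–6% to
hcp/fcc two-shells at equal cutoff) and is a slack-only certificate problem of Flyspeck type, whose
potential-independent half
(tame-graph enumeration of near-kissing fans; LJ bulk fans ARE Hales fans: second shell 1.373 =
1.414·a* > 1.26·a*) is verified
technology (Hales2012 arXiv:1209.6043, HalesFlyspeck2012). Imported areas: certified computation /
interval B&B (far field),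
atomistic-to-continuum elasticity (near field), discrete geometry of packings (case split),
topological-dynamics hull
reasoning only through the borrowed back end (HullPeriodicPoint).
RANKED CRUXES. 2 EfcBadOnlyGap (far field, slack-only; hardest and most informative: a single
1/20-bad two-shell environment
within o(1) of e* after the best transfer kills the line). 3 EfcCompactStability (near field =
phonon/elastic positivity +
nonlinear radius ≥ 5%). 4 EfcInterfaceGlue (E4 of the card: interface levy + tail charge; g > C_tail
decides the certificate
radius). 5 EfcHullBridge (soft: zero density at every ε ⇒ LayeredWindows via the PROVED
HalesDSP_layerPackings_holds).
Support (verbatim shared): 0626, 0627, 3240–3243. No unproved NAMED Literature fact is in the import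
cone of any crux
(LennardJonesMinimalDistance_holds, LennardJonesGroundStatesExist_holds,
HalesDSP_layerPackings_holds are proved).
KILL CRITERIA. (i) A δ-separated all-bad configuration family with 𝓔/N → e* (e.g. a non-close-packed
periodic structure, a
Frank–Kasper phase, or a quasicrystal within certificate error of e*) refutes EfcBadOnlyGap and
closes the route. (ii) A
certified non-positive phonon branch or elastic constant of LJ hcp/fcc on the window, or a
good-preserving compact rearrangement
with ΔE < 0, refutes EfcCompactStability: close (the equality-free doctrine has no near field left).
(iii) If the glue provably
needs g > C_tail with C_tail above every two-shell far-field gap, the certificate radius must grow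
to 3 shells (~80 neighbours):
infeasible in practice → close as exhausted with census. (iv) Refutation of 0627/3242 kills conjunct
(i)/(ii) for everyone.
TWO-LAYER PLAN (D-0019; not filed now). EfcBadOnlyGap ⇐ {TruncatedTransferCertificate_R (pointwise
score ≥ e*_R + g on decorated
tame fans, kit-certified), TailCharge (averaged r⁻⁶ tail ≤ Barlow value + C·bad fraction; Kepler
density bound)} glued by a sum.
EfcCompactStability ⇐ {PhononPositivityHcpFcc (interval Bloch eigenvalues + Lipschitz on the BZ),
CoRotatedConvexity (E–Ming
type lemma)}. EfcInterfaceGlue ⇐ {levy protocol with explicit constants once numerics fix R}. 2-D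
LJ(12,6) dress rehearsal =
a support target to be filed when a prover asks (calibration, itself open: BlancLewin2015 §2.3).
NOT DECOMPOSED (deliberately): the transfer rule's locality format (shared in spirit with
FrustrationRangeLP's Φ, stmt-3423);
relaxed polytypes in the near field (uniform-spacing Barlow stackings other than hcp/fcc are NOT
equilibria — second-layer
vertical forces — so CompactStability is stated for hcp/fcc only); the explicit min-distance of LJ
ground states beyond the
proved δ = 1/3 (B&B practicality, not truth); definitions fccTwoShellPattern / hcpTwoShellPattern /
IsTwoShellGood (requested;
items restatable verbatim once they land); the 2-D calibration rung.

Novelty: Nearest prior art: (a) in print, Flyspeck's architecture (HalesDSP2012 Ch. 6–7; HalesEtAl2015) —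
isolate the optimum, certify only strict inequalities — for DENSITY, where no harmonic near field
exists; (b) in hub, route FrustrationRangeLP (stmt-3423 CoordinationGapCertificates): pointwise
transfer certificates with a defect BUDGET θ and level R(θ) → ∞, i.e. equality avoided by letting
the certified constant c stay below e*; (c) route CrystalLocalRigidity (a): e_loc ≥ e* with equality
iff Barlow + quantitative stability (the equality case certified).
Delta: the equality stratum is removed ANALYTICALLY (phonon/elastic convexity of LJ hcp/fcc in
co-rotated frames, EfcCompactStability) so that the computer certifies a gap at a FIXED two-shell
radius (EfcBadOnlyGap, all-bad configurations only), the defect predicate is the 18-point two-shell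
pattern (stacking-blind by design, octahedral sites visible — the level at which icosahedral centres
lose), and the output is typed as a coercive inequality 𝓔 ≥ N e* + g·#bad at every tolerance that
lands verbatim on LayeredWindows (stmt-3241) through the proved HalesDSP_layerPackings_holds. Grade
claimed: new-combination (as audited).
Searched this session: lit frontier AtomisticToContinuum --since 2020 (crystallization descendants:
arXiv:2604.19239 Kreutz–Ziereis polycrystals, arXiv:2407.20762 2-D arbitrary norm — nothing 3-D for
pure pairs); lit search --hybrid "Cauchy-Born harmonic stability Lennard-Jones lattice validated
numerics" (→ Be  [refs: 10.1007/s00205-018-1327-0, 10.1007/s00205-006-0031-7, 10.1007/s00332-002-0495-z, 10.1002/cpa.10048, 2604.19239, 2407.20762, 2107.14020, 1209.6043, 2506.22614, 1608.06155, doi:10.1007/s00205-018-1327-0, doi:10.1007/s00205-006-0031-7, doi:10.1007/s00332-002-0495-z, doi:10.1002/cpa.10048, HalesDSP2012, HalesEtAl2015, BeterminSamajTravenec2022, EMing2006, FrieseckeTheil2002, FrieseckeJamesMuller2002, ]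

Barriers (technique_class: discharging-lp phonon-near-field local-energy-inequality): technique_class: discharging-lp phonon-near-field local-energy-inequality
- Literature.Barriers.AtomisticToContinuum.TetrahedralFrustration: APPLIES to any pure single-cell
(Voronoi/Delaunay/one-centre first-shell) version of the far-field inequality; evaded as Flyspeck
evades it — zero-sum transfers between neighbouring particles (hybrid scoring) and a two-shell
score; the barrier bites again exactly in EfcInterfaceGlue (g > C_tail decides whether two shells
suffice) — declared kill criterion (iii).
- Literature.Barriers.AtomisticToContinuum.IcosahedralClusters: APPLIES to first-shell-only
inequalities (LJ₁₃ is icosahedral; both close-packed first shells lose); evaded by the 18-point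
two-shell predicate and score (octahedral sites at √2·a); no finite-N exactness is used anywhere
(EfcBadOnlyGap allows g tiny; small clusters are all-surface = all-bad and satisfy it with room).
- Literature.Barriers.AtomisticToContinuum.FlexibleKissingArrangements: not met — nothing is
inferred from ONE 12-shell; goodness is a two-shell, scale-and-rotation-fitted 18-point match, and
the far field treats flexible families as branch-and-bound boxes (a dimension count, not an
obstruction); the bridge applies the GLOBAL proved HalesDSP_layerPackings_holds to an
everywhere-exact limit.
- Literature.Barriers.AtomisticToContinuum.KissingTwelveDegeneracy: respected — the certificate is
deliberately stacking-blind (fcc and hcp two-shells both good); stacking selection happens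
downstream in the hull (bor

History (route lifecycle, newest last):
- 2026-08-15T13:42:13Z · CLOSED retired — not-a-thesis: assembly does not conclude the sub-problem Statement (operator:999:1257524)

sub-problem: Crystallization · status: closed(retired) · opened planner-plancard-AtomisticToContinuum-Crystal-6670e008-0 2026-08-15T11:26:15Z · rev 0 · ledger route-AtomisticToContinuum-EqualityFreeCertificates
GENERATED by the gate from the ledger (D-0016/17). Provers cite these decls: `theorem foo : Summit.AtomisticToContinuum.Crystallization.Theses.EqualityFreeCertificates.<Decl> := …` in Summits/AtomisticToContinuum/Crystallization/Theorems/<Name>.lean.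
-/

namespace Summit.AtomisticToContinuum.Crystallization.Theses.EqualityFreeCertificates

open scoped BigOperators Topology Manifold Classical MeasureTheory ProbabilityTheory Matrix InnerProductSpace ComplexConjugate ContinuousMap
open Filter Set Function TopologicalSpace MeasureTheory

attribute [summit_statement] _root_.Crystallization

/-- item stmt-AtomisticToContinuum-3949 · target · rank 0 · closed · moot by None · by planner
why it might fail: Crystallization-strength: fails iff δ-separated configurations with a positive fraction of ε-bad particles come within o(N) of N·e* — polytetrahedral bulk order, a non-close-packed periodic competitor degenerate with hcp/fcc, or near-threshold strains (gap only ~c·ε²).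
sources: BlancLewin2015, HalesDSP2012, Hales2012, EMing2006, Literature.Barriers.AtomisticToContinuum.IcosahedralClusters, Literature.Barriers.AtomisticToContinuum.TetrahedralFrustration
[target] COERCIVE TWO-SHELL GAP (the card's H3 engine + energy lower bound): for every tolerance ε ∈
(0, 1/20] and separation δ > 0 there is g > 0 such that every δ-separated N-point configuration x in
ℝ³ satisfies 𝓔_LJ(x) ≥ N·e* + g·#{i : particle i is NOT ε-good}, e* = ⨅_Q e(Q) over periodic
configurations. ε-GOOD (inline; definitions fccTwoShellPattern/hcpTwoShellPattern requested): ∃ a ∈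
[47/50,1], A linear isometry, P₂ ∈ {fcc, hcp} 18-point two-shell pattern and an injective f : P₂ →
particles with |x_{f v} − (x_i + a·A v)| ≤ ε·a and every particle within 3a/2 of x_i hit (two-way
match; surface particles are bad). The g = 0 skeleton is free (periodisation 0715: N e* ≤ 𝓔(x) for
every finite x); the content is coercivity. Consequences: liminf-side of 0626 and, with E(N)/N → e*,
ZERO DENSITY of ε-bad particles in LJ ground states at every ε (⇒ EfcHullBridge). Monotone in ε and
δ (smaller ε = more bad particles, g(ε) ~ c·ε² expected from the near field; g may depend on δ).
Sources: card equality-free-certificates-phonon-near-field; BlancLewin2015 §2.3; HalesDSP2012 Ch. 6. -/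
@[route_item "route-AtomisticToContinuum-EqualityFreeCertificates"]
def EfcCoerciveGap : Prop :=
  ∀ ε : ℝ, 0 < ε → ε ≤ 1 / 20 → ∀ δ : ℝ, 0 < δ → ∃ g : ℝ, 0 < g ∧ ∀ (N : ℕ) (x : Fin N → EuclideanSpace ℝ (Fin 3)), (∀ i j : Fin N, i ≠ j → δ ≤ dist (x i) (x j)) → (N : ℝ) * (⨅ Q : Literature.MathematicalPhysics.StatisticalMechanics.PeriodicConfiguration 3, Q.energyPerParticle Literature.MathematicalPhysics.StatisticalMechanics.lennardJones) + g * (Nat.card {i : Fin N // ¬ (∃ a : ℝ, 47 / 50 ≤ a ∧ a ≤ 1 ∧ ∃ (A : EuclideanSpace ℝ (Fin 3) →ₗᵢ[ℝ] EuclideanSpace ℝ (Fin 3)) (P : Finset (EuclideanSpace ℝ (Fin 3))) (f : EuclideanSpace ℝ (Fin 3) → Fin N), (P = Literature.Geometry.DiscreteGeometry.scaledPattern (Literature.Geometry.DiscreteGeometry.fccInt ∪ {![2, 0, 0], ![-2, 0, 0], ![0, 2, 0], ![0, -2, 0], ![0, 0, 2], ![0, 0, -2]}) 2 ∨ P = Literature.Geometry.DiscreteGeometry.scaledPattern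 (Literature.Geometry.DiscreteGeometry.hcpInt ∪ {![6, 0, 0], ![0, 6, 0], ![0, 0, 6], ![2, -4, -4], ![-4, 2, -4], ![-4, -4, 2]}) 18) ∧ (∀ v ∈ P, f v ≠ i ∧ dist (x (f v)) (x i + a • A v) ≤ ε * a) ∧ Set.InjOn f ↑P ∧ ∀ j : Fin N, j ≠ i → dist (x j) (x i) ≤ 3 / 2 * a → ∃ v ∈ P, f v = j)} : ℝ) ≤ Literature.MathematicalPhysics.StatisticalMechanics.interactionEnergy Literature.MathematicalPhysics.StatisticalMechanics.lennardJones x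

/-- item stmt-AtomisticToContinuum-3950 · crux · rank 2 · closed · moot by None · by planner
why it might fail: A 1/20-bad two-shell environment within g→0 of e* after the best transfer: near-threshold strains have gap only ~c/400 (tiny slack, B&B blow-up); Frank–Kasper/A15 or quasicrystal competitors within certificate error; worst-case r⁻⁶ tail beyond two shells eating the slack.
sources: Hales2012, HalesDSP2012, HalesFlyspeck2012, HalesEtAl2015, BeterminSamajTravenec2022, Stillinger2001
[crux] FAR FIELD, SLACK ONLY (E3 of the card): for every δ > 0 there is g > 0 such that every
δ-separated N-point configuration in which EVERY particle is 1/20-bad (no particle has an 18-point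
two-shell environment 1/20-matched, at a scale a ∈ [47/50,1] and after a rotation, to the fcc or hcp
two-shell pattern) has 𝓔_LJ ≥ N·(e* + g). No perfect-crystal (equality) configuration is in scope:
crystal blocks have good interiors, so what remains are small clusters (all surface), films,
amorphous/polytetrahedral bulk, over-strained or out-of-window crystals (gap ~ elastic modulus ×
strain², positive), non-close-packed lattices (bcc, A15, σ, Laves …), defect-saturated crystals.
Intended proof = the special case G = ∅ of the architecture: pointwise score e_i + Σ_j τ_ij ≥ 2(e* +
g) with a zero-sum finite-range transfer τ found by LP over decorated tame (Hales) fans and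
certified by interval branch-and-bound at two-shell radius, plus a worst-case r⁻⁶ tail bound
(sum_inv_pow_six_le in tree) merged into the slack. Special case of EfcCoerciveGap (bad count = N).
Fastest refutation: a periodic non-Barlow structure or quasicrystal with e(Q) within 1e-3·|e*| of
e_hcp (check BeterminSamajTravenec20 -/
@[route_item "route-AtomisticToContinuum-EqualityFreeCertificates"]
def EfcBadOnlyGap : Prop :=
  ∀ δ : ℝ, 0 < δ → ∃ g : ℝ, 0 < g ∧ ∀ (N : ℕ) (x : Fin N → EuclideanSpace ℝ (Fin 3)), (∀ i j : Fin N, i ≠ j → δ ≤ dist (x i) (x j)) → (∀ i : Fin N, ¬ (∃ a : ℝ, 47 / 50 ≤ a ∧ a ≤ 1 ∧ ∃ (A : EuclideanSpace ℝ (Fin 3) →ₗᵢ[ℝ] EuclideanSpace ℝ (Fin 3)) (P : Finset (EuclideanSpace ℝ (Fin 3))) (f : EuclideanSpace ℝ (Fin 3) → Fin N), (P = Literature.Geometry.DiscreteGeometry.scaledPattern (Literature.Geometry.DiscreteGeometry.fccInt ∪ {![2, 0, 0], ![-2, 0, 0], ![0, 2, 0], ![0, -2, 0], ![0, 0, 2],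 ![0, 0, -2]}) 2 ∨ P = Literature.Geometry.DiscreteGeometry.scaledPattern (Literature.Geometry.DiscreteGeometry.hcpInt ∪ {![6, 0, 0], ![0, 6, 0], ![0, 0, 6], ![2, -4, -4], ![-4, 2, -4], ![-4, -4, 2]}) 18) ∧ (∀ v ∈ P, f v ≠ i ∧ dist (x (f v)) (x i + a • A v) ≤ a / 20) ∧ Set.InjOn f ↑P ∧ ∀ j : Fin N, j ≠ i → dist (x j) (x i) ≤ 3 / 2 * a → ∃ v ∈ P, f v = j)) → (N : ℝ) * ((⨅ Q : Literature.MathematicalPhysics.StatisticalMechanics.PeriodicConfiguration 3, Q.energyPerParticle Literature.MathematicalPhysics.StatisticalMechanics.lennardJones) + g) ≤ Literature.MathematicalPhysics.StatisticalMechanics.interactionEnergy Literature.MathematicalPhysics.StatisticalMechanics.lennardJones x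

/-- item stmt-AtomisticToContinuum-3951 · crux · rank 3 · closed · moot by None · by planner
why it might fail: Needs strict phonon AND elastic positivity of LJ hcp/fcc on the whole (a,h) window plus a nonlinear validity radius ≥ 5% two-shell distortion; a soft shear branch under the ±2.5% window strain, or a good-preserving rearrangement (slow rotations, incipient slip) with ΔE < 0, refutes it.
sources: EMing2006, FrieseckeTheil2002, FrieseckeJamesMuller2002, AyalaChoksiWirth2025, doi:10.1007/s00205-018-1327-0, Stillinger2001
[crux] NEAR FIELD = COMPACT GOOD-PRESERVING STABILITY OF THE PERFECT CRYSTALS (E1–E2 of the card in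
their cleanest form): for S ∈ {hcpStacking, fccStacking} and all parameters a ∈ [24/25, 49/50]
(window around the LJ equilibrium nn distance a* ≈ 0.9712), |h² − 2a²/3| ≤ a²/100 (c/a within ±0.75%
of ideal): if finitely many sites F ⊂ S(a,h) are moved injectively to new positions φ(F) avoiding
the untouched sites, and in the resulting configuration Y = (S∖F) ∪ φ(F) EVERY particle is 1/20-good
(two-shell fcc/hcp environment at some scale a' ∈ [47/50,1]), then the energy change ΔE =
Σ_{p≠q∈F}[V(|φp−φq|)−V(|p−q|)]/2 + Σ_{p∈F}Σ'_{y∈S∖F}[V(|φp−y|)−V(|p−y|)] is ≥ 0. Forces vanish at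
every site of hcp/fcc by symmetry for all (a,h), so this is a second-order statement: certified
positive-definiteness of the LJ force-constant operator (all Bloch wave vectors) and of the elastic
tensor on the window (E2: interval linear algebra on a Brillouin-zone grid + Lipschitz bounds; ACW
2025 did fcc N = 864 by Krawczyk) plus a geometric-nonlinear validity radius covering 5% two-shell
distortions in co-rotated frames (E1: E–Ming / Friesecke–Theil / FJM). Good-preservation excludes
restacking (partial-dislo -/
@[route_item "route-AtomisticToContinuum-EqualityFreeCertificates"]
def EfcCompactStability : Prop :=
  ∀ S : ℝ → ℝ → Set (EuclideanSpace ℝ (Fin 3)), (S = Literature.MathematicalPhysics.StatisticalMechanics.hcpStacking ∨ S = Literature.MathematicalPhysics.StatisticalMechanics.fccStacking) → ∀ a h : ℝ, 24 / 25 ≤ a → a ≤ 49 / 50 → |h ^ 2 - 2 / 3 * a ^ 2| ≤ a ^ 2 / 100 → ∀ (F : Finset (EuclideanSpace ℝ (Fin 3))) (φ : EuclideanSpace ℝ (Fin 3) → EuclideanSpace ℝ (Fin 3)), ↑F ⊆ S a h → Set.InjOn φ ↑F → (∀ p ∈ F, φ p ∉ S a h \ ↑F) → (∀ q ∈ ((S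 a h \ ↑F) ∪ φ '' ↑F), ∃ a' : ℝ, 47 / 50 ≤ a' ∧ a' ≤ 1 ∧ ∃ (A : EuclideanSpace ℝ (Fin 3) →ₗᵢ[ℝ] EuclideanSpace ℝ (Fin 3)) (P : Finset (EuclideanSpace ℝ (Fin 3))) (f : EuclideanSpace ℝ (Fin 3) → EuclideanSpace ℝ (Fin 3)), (P = Literature.Geometry.DiscreteGeometry.scaledPattern (Literature.Geometry.DiscreteGeometry.fccInt ∪ {![2, 0, 0], ![-2, 0, 0], ![0, 2, 0], ![0, -2, 0], ![0, 0, 2], ![0, 0, -2]}) 2 ∨ P = Literature.Geometry.DiscreteGeometry.scaledPattern (Literature.Geometry.DiscreteGeometry.hcpInt ∪ {![6, 0, 0], ![0, 6, 0], ![0, 0, 6], ![2, -4, -4], ![-4, 2, -4], ![-4, -4, 2]}) 18) ∧ (∀ v ∈ P, f v ∈ ((S a h \ ↑F) ∪ φ '' ↑F) ∧ dist (f v) (q + a' • A v) ≤ a' / 20) ∧ Set.InjOn f ↑P ∧ ∀ y ∈ ((S a h \ ↑F) ∪ φ '' ↑F), y ≠ q → dist y q ≤ 3 / 2 * a' → ∃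 v ∈ P, f v = y) → 0 ≤ (∑ p ∈ F, ∑ q ∈ F.erase p, (Literature.MathematicalPhysics.StatisticalMechanics.lennardJones (dist (φ p) (φ q)) - Literature.MathematicalPhysics.StatisticalMechanics.lennardJones (dist p q)) / 2) + ∑ p ∈ F, ∑' y : {y : EuclideanSpace ℝ (Fin 3) // y ∈ S a h ∧ y ∉ F}, (Literature.MathematicalPhysics.StatisticalMechanics.lennardJones (dist (φ p) y.1) - Literature.MathematicalPhysics.StatisticalMechanics.lennardJones (dist p y.1))

/-- item stmt-AtomisticToContinuum-3952 · crux · rank 4 · closed · moot by None · by planner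
why it might fail: The levy: bad particles must pay interface and tail deficits of adjacent good regions from their own gap; mildly bad ones have gap ~c/400 while flat tail/interface charges are O(0.1|e*|) — unless charges scale with distortion, g > C_tail fails at two shells (3-shell certificate needed).
sources: HalesDSP2012, Theil2006, FlatleyTheil2015, FrieseckeJamesMuller2002, arXiv:1608.06155, Literature.Barriers.AtomisticToContinuum.TetrahedralFrustration
[crux] GLUING (E4 of the card): EfcBadOnlyGap → EfcCompactStability → EfcCoerciveGap. The
antecedents are the two regimes in their robust typed forms; the implication is where the
architecture's bookkeeping lives: partition particles into good (G) and bad (B); near field: Σ_{i∈G}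
e_i ≥ 2e*·|G| − (interface levy), from compact stability of the local Barlow reference in co-rotated
frames with FJM rigidity handling slowly rotating grains (grain walls are bad); far field:
Σ_{i∈B}(e_i + Σ_j τ_ij) ≥ (2e* + 2g)|B| + (levy received), transfers zero-sum; tail: the r⁻⁶
interaction beyond the certificate radius charged through an averaged inequality 'mean tail
attraction ≤ Barlow value + C·(bad fraction)' (Kepler's theorem caps density at given minimal
distance). Coercivity survives iff g > C_tail + C_interface per bad particle — the inequality that
fixes the certificate radius R (expected 2–2.5 shells). Mildly bad particles (strain just above the
threshold) have gap only ~c·ε², so the levy protocol must charge interfaces in proportion to the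
actual distortion (smooth defect measure), not at a flat rate: this is the open design point
deliberately not frozen into the typed antecedents. For ε < -/
@[route_item "route-AtomisticToContinuum-EqualityFreeCertificates"]
def EfcInterfaceGlue : Prop :=
  EfcBadOnlyGap → EfcCompactStability → EfcCoerciveGap

/-- item stmt-AtomisticToContinuum-3953 · crux · rank 5 · closed · moot by None · by planner
why it might fail: Soft (compactness + proved HalesDSP_layerPackings_holds) but long: local-limit extraction for separated ground states, diagonal ε_N → 0, exact-two-shell-good ⇒ IsUnitBallPacking ∧ HasFccOrHcpShells at scale a; fails only via a window mismatch ([47/50,1], [39/50,17/20]·a) with the limit.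
sources: HalesDSP2012, Hales2012, BlancLewin2015, Radin1991, stmt-AtomisticToContinuum-3241, stmt-AtomisticToContinuum-0626
[crux] BRIDGE TO THE HULL BACK END: EfcCoerciveGap → [E(N)/N → e*, the shared bookkeeping item 0626,
inlined] → LayeredWindows (the rank-2 crux stmt-3241 of route HullPeriodicPoint, inlined verbatim;
also filed here as support EfcLayeredWindows). Proof plan (soft, but real Lean work): ground states
x^N are 1/3-separated (LennardJonesMinimalDistance_holds, proved) and 𝓔(x^N) = E(N) ≤ N e* + o(N),
so #ε-bad = o(N) for every ε; pick ε_N → 0 and radii R_N → ∞ slowly with #{i : B_{R_N}(x_i) contains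
an ε_N-bad particle} = o(N) (packing bound card_le_of_separated_of_dist_le; surface particles are
bad by definition, so all-good balls are automatically bulk); extract a local (vague) limit S of
recentred configurations: an infinite point set every point of which is EXACTLY two-shell good at
one common scale a ∈ [47/50,1] (scales agree along bonds); then S is a packing of balls of diameter
a with HasFccOrHcpShells, so the PROVED HalesDSP_layerPackings_holds (LayerStackings.lean) makes S a
rigid image of barlowStacking a (a√(2/3)) s — a layered set with z(m+1) − z(m) = a√(2/3) ∈ [39a/50,
17a/20] — and the windows of x^N converging to S give LayeredWindows (one a for all R, frequently in
N, to -/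
@[route_item "route-AtomisticToContinuum-EqualityFreeCertificates"]
def EfcHullBridge : Prop :=
  EfcCoerciveGap → (Filter.Tendsto (fun N : ℕ => Literature.MathematicalPhysics.StatisticalMechanics.groundStateEnergy Literature.MathematicalPhysics.StatisticalMechanics.lennardJones 3 N / N) Filter.atTop (nhds (⨅ Q : Literature.MathematicalPhysics.StatisticalMechanics.PeriodicConfiguration 3, Q.energyPerParticle Literature.MathematicalPhysics.StatisticalMechanics.lennardJones))) → ∀ x : (N : ℕ) → (Fin N → EuclideanSpace ℝ (Fin 3)), (∀ N, Literature.MathematicalPhysics.StatisticalMechanics.IsGroundState Literature.MathematicalPhysics.StatisticalMechanics.lennardJones (x N)) → ∃ a : ℝ, 47 / 50 ≤ a ∧ a ≤ 1 ∧ ∀ R ε : ℝ, 0 < ε → ∃ᶠ N in Filter.atTop, ∃ (A : EuclideanSpace ℝ (Fin 3) →ₗᵢ[ℝ] EuclideanSpace ℝ (Fin 3)) (t : EuclideanSpace ℝ (Fin 3)) (s : ℤ → ℤ) (z : ℤ → ℝ), Literature.MathematicalPhysics.StatisticalMechanics.IsHaggSeq s ∧ (∀ m : ℤ, 39 / 50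 * a ≤ z (m + 1) - z m ∧ z (m + 1) - z m ≤ 17 / 20 * a) ∧ let S : Set (EuclideanSpace ℝ (Fin 3)) := {p | ∃ m i j : ℤ, p = A (((i : ℝ) • Literature.MathematicalPhysics.StatisticalMechanics.triangularVec₁ a) + ((j : ℝ) • Literature.MathematicalPhysics.StatisticalMechanics.triangularVec₂ a) + ((Literature.MathematicalPhysics.StatisticalMechanics.haggLabel s m : ℝ) • Literature.MathematicalPhysics.StatisticalMechanics.barlowOffset a) + (z m • Literature.MathematicalPhysics.StatisticalMechanics.layerNormal 1))}; (∀ p ∈ S, ‖p‖ ≤ R → ∃ i : Fin N, dist (x N i + t) p ≤ ε) ∧ (∀ i : Fin N, ‖x N i + t‖ ≤ R → ∃ p ∈ S, dist (x N i + t) p ≤ ε)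

/-- item stmt-AtomisticToContinuum-0626 · support · rank 9 · closed · proved by Summit.AtomisticToContinuum.Crystallization.Theorems.crysEnergyLimit_proof @ de27d46e58f4 (prover) · by planner
Energetic crystallization: E(N)/N converges to the infimum over periodic (multi-lattice)
configurations of the LJ energy per particle in d = 3. Lower bound liminf ≥ ⨅ is the content ((a)
local optimality + (d) + surface term O(N^{2/3})); upper bound is filed separately. -/
@[route_item "route-AtomisticToContinuum-EqualityFreeCertificates"]
def EfcEnergyLimit : Prop :=
  Filter.Tendsto (fun N : ℕ => Literature.MathematicalPhysics.StatisticalMechanics.groundStateEnergy Literature.MathematicalPhysics.StatisticalMechanics.lennardJones 3 N / N) Filter.atTop (nhds (⨅ Q : Literature.MathematicalPhysics.StatisticalMechanics.PeriodicConfiguration 3, Q.energyPerParticle Literature.MathematicalPhysics.StatisticalMechanics.lennardJones))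

/-- item stmt-AtomisticToContinuum-0627 · support · rank 9 · open · by planner
The infimum over periodic configurations of ℝ³ of the Lennard-Jones energy per particle is attained
(by some lattice G and finite motif F). Needs stacking selection (c) + compactness of near-optimal
periodic configurations at bounded density / bounded-below distances; refuted if optimal LJ
stackings are aperiodic with unattained infimum (route RefuteCrystalPeriodicMin). -/
@[route_item "route-AtomisticToContinuum-EqualityFreeCertificates"]
def EfcPeriodicMinAttained : Prop :=
  ∃ P : Literature.MathematicalPhysics.StatisticalMechanics.PeriodicConfiguration 3, IsLeast (Set.range fun Q : Literature.MathematicalPhysics.StatisticalMechanics.PeriodicConfiguration 3 => Q.energyPerParticle Literature.MathematicalPhysics.StatisticalMechanics.lennardJones) (P.energyPerParticle Literature.MathematicalPhysics.StatisticalMechanics.lennardJones)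

/-- item stmt-AtomisticToContinuum-3240 · support · rank 9 · open · by planner
[target] PERIODIC WINDOWS (finite form of "some local limit of translated LJ ground states has a
non-empty periodic configuration in its orbit closure"): for every sequence of Lennard-Jones ground
states x^N in ℝ³ there is one periodic configuration P such that for every R and every ε > 0,
frequently in N, some translate x^N + t is two-way ε-matched with P.points on the closed ball B(0,R)
(every site of P in the ball has a particle within ε and every particle in the ball has a site
within ε). Equivalent to IsCrystallizing lennardJones 3 (HullCriterion + HullCriterionConverse). -/
@[route_item "route-AtomisticToContinuum-EqualityFreeCertificates"]
def PeriodicWindows : Prop :=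
  ∀ x : (N : ℕ) → (Fin N → EuclideanSpace ℝ (Fin 3)), (∀ N, Literature.MathematicalPhysics.StatisticalMechanics.IsGroundState Literature.MathematicalPhysics.StatisticalMechanics.lennardJones (x N)) → ∃ P : Literature.MathematicalPhysics.StatisticalMechanics.PeriodicConfiguration 3, ∀ R ε : ℝ, 0 < ε → ∃ᶠ N in Filter.atTop, ∃ t : EuclideanSpace ℝ (Fin 3), (∀ s ∈ P.points, ‖s‖ ≤ R → ∃ i : Fin N, dist (x N i + t) s ≤ ε) ∧ (∀ i : Fin N, ‖x N i + t‖ ≤ R → ∃ s ∈ P.points, dist (x N i + t) s ≤ ε)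

/-- item stmt-AtomisticToContinuum-3241 · support · rank 9 · closed · moot by None · by planner
[crux] LAYERED WINDOWS (card item H2 'layering of one limit'; the genuinely 3-D crux): for every
sequence of LJ ground states x^N there is an in-layer spacing a ∈ [47/50, 1] such that for every R
and ε > 0, frequently in N, there are a linear isometry A, a translation t, a Hägg word s (IsHaggSeq
s) and layer heights z : ℤ → ℝ with all increments z(m+1) − z(m) ∈ [39a/50, 17a/20] (the box B of
route PoissonBesselStacking, so that its typed LjRegistryDomination stmt-3063 applies verbatim),
such that x^N + t is two-way ε-matched on B(0,R) with the rigid image A '' S of the layered set S =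
{ i·u(a) + j·v(a) + L_s(m)·w(a) + z(m)·e₃ : m i j ∈ ℤ } (triangular layers of spacing a, consecutive
layers in distinct hole positions A/B/C coded by haggLabel s, FREE interlayer spacings — so faulted
and polytypic stackings with their relaxed spacings are admitted; nothing is claimed for all but
o(N) particles, only for one window per scale infinitely often). [difficulty: XL] -/
@[route_item "route-AtomisticToContinuum-EqualityFreeCertificates"]
def EfcLayeredWindows : Prop :=
  ∀ x : (N : ℕ) → (Fin N → EuclideanSpace ℝ (Fin 3)), (∀ N, Literature.MathematicalPhysics.StatisticalMechanics.IsGroundState Literature.MathematicalPhysics.StatisticalMechanics.lennardJones (x N)) → ∃ a : ℝ, 47 / 50 ≤ a ∧ a ≤ 1 ∧ ∀ R ε : ℝ, 0 < ε → ∃ᶠ N in Filter.atTop, ∃ (A : EuclideanSpace ℝ (Fin 3) →ₗᵢ[ℝ] EuclideanSpace ℝ (Fin 3)) (t : EuclideanSpace ℝ (Fin 3)) (s : ℤ → ℤ) (z : ℤ → ℝ), Literature.MathematicalPhysics.StatisticalMechanics.IsHaggSeq s ∧ (∀ m : ℤ, 39 / 50 * a ≤ z (m + 1) - z m ∧ z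 (m + 1) - z m ≤ 17 / 20 * a) ∧ let S : Set (EuclideanSpace ℝ (Fin 3)) := {p | ∃ m i j : ℤ, p = A (((i : ℝ) • Literature.MathematicalPhysics.StatisticalMechanics.triangularVec₁ a) + ((j : ℝ) • Literature.MathematicalPhysics.StatisticalMechanics.triangularVec₂ a) + ((Literature.MathematicalPhysics.StatisticalMechanics.haggLabel s m : ℝ) • Literature.MathematicalPhysics.StatisticalMechanics.barlowOffset a) + (z m • Literature.MathematicalPhysics.StatisticalMechanics.layerNormal 1))}; (∀ p ∈ S, ‖p‖ ≤ R → ∃ i : Fin N, dist (x N i + t) p ≤ ε) ∧ (∀ i : Fin N, ‖x N i + t‖ ≤ R → ∃ p ∈ S, dist (x N i + t) p ≤ ε)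

/-- item stmt-AtomisticToContinuum-3242 · support · rank 9 · closed · moot by None · by planner
[crux] PERIODIC GIVEN LAYERED (card items H2/H3 'zero fault density suffices'; stacking selection
INSIDE THE HULL): for every sequence of LJ ground states, if it has layered windows at every scale
in the sense of LayeredWindows (same a, A, t, s, z data), then it has periodic windows at every
scale in the sense of PeriodicWindows (one periodic configuration P — expected: relaxed HCP, a
rotated barlowPeriodicConfiguration of the alternating word, but ANY periodic polytype is allowed,
so non-uniform relaxed spacings of longer periods do not falsify it). Intended mechanism: Hägg
domination on the box (typed: LjRegistryDomination stmt-3063 of route PoissonBesselStacking, margin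
≥ 287 by its numerics, feeding the Peierls count HaggDominationAllRanges stmt-0737) + cut-and-paste
minimality of local limits ⇒ stacking faults have zero density in every layered energy-minimising
limit ⇒ fault-free slabs of every thickness ⇒ (exponential registry decoupling) relaxed-HCP windows
of every size; only a SYNDETIC (bounded-gap) fault pattern in every layered limit could defeat it.
[deps: LayeredWindows] [difficulty: L] -/
@[route_item "route-AtomisticToContinuum-EqualityFreeCertificates"]
def EfcPeriodicGivenLayered : Prop :=
  ∀ x : (N : ℕ) → (Fin N → EuclideanSpace ℝ (Fin 3)), (∀ N, Literature.MathematicalPhysics.StatisticalMechanics.IsGroundState Literature.MathematicalPhysics.StatisticalMechanics.lennardJones (x N)) → (∃ a : ℝ, 47 / 50 ≤ a ∧ a ≤ 1 ∧ ∀ R ε : ℝ, 0 < ε → ∃ᶠ N in Filter.atTop, ∃ (A : EuclideanSpace ℝ (Fin 3) →ₗᵢ[ℝ] EuclideanSpace ℝ (Fin 3)) (t : EuclideanSpace ℝ (Fin 3)) (s : ℤ → ℤ) (z : ℤ → ℝ), Literature.MathematicalPhysics.StatisticalMechanics.IsHaggSeq s ∧ (∀ m : ℤ, 39 / 50 * a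 ≤ z (m + 1) - z m ∧ z (m + 1) - z m ≤ 17 / 20 * a) ∧ let S : Set (EuclideanSpace ℝ (Fin 3)) := {p | ∃ m i j : ℤ, p = A (((i : ℝ) • Literature.MathematicalPhysics.StatisticalMechanics.triangularVec₁ a) + ((j : ℝ) • Literature.MathematicalPhysics.StatisticalMechanics.triangularVec₂ a) + ((Literature.MathematicalPhysics.StatisticalMechanics.haggLabel s m : ℝ) • Literature.MathematicalPhysics.StatisticalMechanics.barlowOffset a) + (z m • Literature.MathematicalPhysics.StatisticalMechanics.layerNormal 1))}; (∀ p ∈ S, ‖p‖ ≤ R → ∃ i : Fin N, dist (x N i + t) p ≤ ε) ∧ (∀ i : Fin N, ‖x N i + t‖ ≤ R → ∃ p ∈ S, dist (x N i + t) p ≤ ε)) → ∃ P : Literature.MathematicalPhysics.StatisticalMechanics.PeriodicConfiguration 3, ∀ R ε : ℝ, 0 < ε → ∃ᶠ N in Filter.atTop, ∃ t : EuclideanSpace ℝ (Fin 3), (∀ s ∈ P.points, ‖s‖ ≤ R → ∃ i : Fin N, dist (x N i + t) s ≤ ε) ∧ (∀ i : Fin N, ‖x N i + t‖ ≤ R →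 ∃ s ∈ P.points, dist (x N i + t) s ≤ ε)

/-- item stmt-AtomisticToContinuum-3243 · support · rank 9 · closed · proved by Summit.AtomisticToContinuum.Crystallization.Theorems.PrestressSplitKorn.stub_hullCriterion @ fa5252dfcb52 (prover) · by planner
[support] HULL CRITERION (card H1, soft, provable now): PeriodicWindows ⇒ IsCrystallizing
lennardJones 3. Proof: Filter.extraction_of_frequently_atTop over (R, ε) = (j+1, 1/(j+1)) gives φ
strictly increasing and translations τ_j; the proved LennardJonesMinimalDistance_holds (δ = 1/3)
gives uniform separation of the translated ground states;
PeriodicConfiguration.tendsto_sum_of_eventually_near' (CrystallizationLocalLimit.lean) gives the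
local convergence with multiplicity m ≡ 1. [difficulty: provable-now] -/
@[route_item "route-AtomisticToContinuum-EqualityFreeCertificates"]
def EfcHullCriterion : Prop :=
  PeriodicWindows → Literature.MathematicalPhysics.StatisticalMechanics.IsCrystallizing Literature.MathematicalPhysics.StatisticalMechanics.lennardJones 3

/-- `EfcHullCriterion` holds: proved by `Summit.AtomisticToContinuum.Crystallization.Theorems.PrestressSplitKorn.stub_hullCriterion` @ fa5252dfcb52. -/
theorem EfcHullCriterion_holds : EfcHullCriterion := _root_.Summit.AtomisticToContinuum.Crystallization.Theorems.PrestressSplitKorn.stub_hullCriterion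

/-- item stmt-AtomisticToContinuum-3954 · assembly · rank 1 · closed · moot by None · by planner
[assembly] EfcBadOnlyGap → EfcCompactStability → EfcInterfaceGlue → EfcEnergyLimit → EfcHullBridge →
EfcPeriodicGivenLayered → EfcHullCriterion → EfcPeriodicMinAttained → Crystallization. Pure logic
over the proved lemma Literature.StatMech.crystallization_of_isLeast_tendsto_isCrystallizing
(Theorems/CrystalLocalRigidityAssembly.lean): term `fun hB hC hG hLim hBr hPGL hHC hMin =>
crystallization_of_isLeast_tendsto_isCrystallizing ⟨hMin, hLim, hHC (fun x hx => hPGL x hx ((hBr (hG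
hB hC) hLim) x hx))⟩` checked rc 0 in the planner's Sketch.lean (EfcHullBridge's inlined bodies are
definitionally the support decls). -/
@[route_item "route-AtomisticToContinuum-EqualityFreeCertificates"]
def Assembly : Prop :=
  EfcBadOnlyGap → EfcCompactStability → EfcInterfaceGlue → EfcEnergyLimit → EfcHullBridge → EfcPeriodicGivenLayered → EfcHullCriterion → EfcPeriodicMinAttained → Literature.MathematicalPhysics.StatisticalMechanics.Crystallization

end Summit.AtomisticToContinuum.Crystallization.Theses.EqualityFreeCertificates
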